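import Summits.QuantumFields.BalabanUV.Beta.ChartConjugationRelativeEnd

/-!
# `BalabanUV.Beta.KernelWardRelative` — the WARD-TRANSVERSALITY END (`hW`) over a RELATIVE inverse, file 1 of 2: generic and packed fibre
# (β sub-cell, row BETA-an1, gen 25; item SKELETON-D1-hW (an1): the kernel-checked ROOT COMPOSITION of the `hW` binder of
# `OneStepKernelFamily.d1Drift_of_D1Tel_D1Rep`; file 2 `KernelWardRelativeEnd` = the dressed family and the `JsBalBmNAtOf` wiring)

HONEST FRAMING (cell contract, verbatim): «discharging `BetaPertH` makes Bałaban's UV stability UNCONDITIONAL — a real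
constructive-QFT result; it is NOT the continuum limit and NOT the Clay problem.»  THIS MODULE mints no `Prop` fact, cites nothing as a
hypothesis, instantiates NO binder of the wall and DISCHARGES NOTHING of it: it is the `hW` twin of an5/an2's `hR` ENDs
`ChartConjugationReflection.axisReflectionCovariant_flip_hessKer_conj` / `ChartConjugationRelativeEnd.axisReflectionCovariant_flipK_hessKer_conj_rel`.
Every jet law, inverse rule and Ward law below is a HYPOTHESIS (socket) of the END, never a fact.

## What is here

The tree's `KernelWard.wardTransversal_flip_hessKer` derives the Ward law from a TWO-SIDED inverse (`(A ∘ divV) ∘ A = A ∘ X − X ∘ A`).  The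
dressed wall family only has a RELATIVE inverse (`ChartConjugationRelative.RelInv G 𝕄 E`: `E ∘ G = G = G ∘ E`, `(G ∘ 𝕄) ∘ E = E = (E ∘ 𝕄) ∘ G`),
so the Ward identity is re-derived as CHART-CONJUGATION INVARIANCE AT THE BARE JET ZERO:
* §0 Tame-currency bookkeeping (`loc_zero`, `tadpole_sub`, `bubble_sub_left`, finite sums);
* §1 GENERIC FIBRE `ward_hess_conj_rel`: (W1′) `divV V y = conjV 𝕄 (X y)` and (W2♮) `divW W y ν y′ = conjW 𝕄 0 (V ν y′) (X y) 0 (X₂ y ν y′) + N y ν y′`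
  with a TADPOLE-NULL remainder `tadpole A (N y ν y′) = 0` (the stripped form of the colour-traceless rotated first-order vertex), `X y`, `X₂`
  localised and commuting with `E` ⟹ `Σ_μ (hess μ (y − e_μ) ν y′ − hess μ y ν y′) = 0`, by `hess_conj_invariant_rel` at `V := 0, W := 0, X′ := 0`;
  `wardTransversal_flip_hessKer_conj_rel` is the difference-variable form (`PolarizationSign.WardTransversal` of the flipped kernel);
* §2 PACKED FIBRE `Fib d`: `divV (vertexOfK K N S) y = Σ_κ′ wsum (Σ_μ Δ_μ colH) (S κ′)` (`divV_vertexOfK`), the finitely supported superpositions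
  `wsum 1_{B(y)}` (`wsum_blockInd`, `wsum_gaugeWt`), and `divV_vertexOfK_eq_conjV`: an ℋ-COLUMN WARD LAW
  `Σ_μ (colH K N μ (y − e_μ) κ′ u − colH K N μ y κ′ u) = c_H · gaugeWt N y κ′ u` (socket `hH`) plus a BLOCK STENCIL WARD LAW WITH CONTACT
  `c_H • Σ_{v ∈ box} divV S (N•y + v) = conjV 𝕄 (X y)` (socket `hSd`) give (W1′) for the chain-rule vertex; the packed END
  `wardTransversal_flipK_hessKer_conj_rel` — conclusion `WardTransversal (flipK (hessKer K (vertexOfK K N J.S) J.W))`.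

All declarations `[folklore]` (trace bookkeeping over absolutely convergent lattice sums); axioms standard.
Provenance: b2b-balaban β sub-cell, unit beta-an1 gen 25, 2026-08-20 (v1); over `KernelWard` / `ChartConjugation(Relative|Reflection)` /
`TameKernelCalculus` / `ResolventReflection` / `StepDriftWitness` / `AxialProjector` BY NAME; no existing file touched.
-/


open Finset
open scoped BigOperators
open Literature.MathematicalPhysics.QuantumFieldTheory
open Literature.MathematicalPhysics.QuantumFieldTheory.Balaban1983to89
open Literature.MathematicalPhysics.QuantumFieldTheory.Balaban1983to89.Beta
open B12Sec2to5 (l1 l1_nonneg)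
open B6BondElimination (unitVec unitVec_apply)
open ExpKernelCalculus (MKer Decays BiLoc comp tr bubble tadpole hess hessKer hess_eq_hessKer BlockCovariant VertexFamily VertexFamily₂ shiftK)
open PolarizationSign (WardTransversal)
open KernelReflection (tadpole_smul bubble_smul_left)
open KernelWard (divV divW)
open AffineAveraging (box toSite)
open AveragingContours (blk off off_mem_box blk_add_off blk_block)
open OneStepResolventKernel (Fib wsum LocStencil JetData)
open OneStepKernelFamily (colH vertexOfK vertexFamily_vertexOfK' flipK)
open StepDriftWitness (comp_zero_right tadpole_zero)
open AxialProjector (toSite_injective)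
open ResolventReflection (vertexOfK_translate_block)
open Summit.QuantumFields.BalabanUV.Beta.TameKernelCalculus
open Summit.QuantumFields.BalabanUV.Beta.ChartConjugation
open Summit.QuantumFields.BalabanUV.Beta.ChartConjugationReflection
open Summit.QuantumFields.BalabanUV.Beta.ChartConjugationRelative

namespace Summit.QuantumFields.BalabanUV.Beta.KernelWardRelative

noncomputable section

/-! ## §0 Tame-currency bookkeeping: zero letters, differences, finite sums -/

section Helpers

variable {D : ℕ} {F : Type*} [Fintype F]

omit [Fintype F] in
/-- [folklore] The zero kernel is localised. -/
theorem loc_zero : Loc (0 : MKer D F) :=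
  ⟨0, 0, 0, 1, one_pos, fun x z a b => by simp only [Pi.zero_apply, abs_zero, zero_mul, le_refl]⟩

/-- [folklore] Composition with the zero kernel on the left vanishes. -/
theorem comp_zero_left (A : MKer D F) : comp 0 A = 0 := by
  funext x z a b
  simp only [ExpKernelCalculus.comp, Pi.zero_apply, zero_mul, Finset.sum_const_zero, tsum_zero]

/-- [folklore] The trace of the zero kernel vanishes. -/
theorem tr_zero : tr (0 : MKer D F) = 0 := by
  simp only [ExpKernelCalculus.tr, Pi.zero_apply, Finset.sum_const_zero, tsum_zero]

/-- [folklore] A bubble with the zero vertex in the first slot vanishes. -/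
theorem bubble_zero_left (A Z : MKer D F) : bubble A 0 Z = 0 := by
  simp only [ExpKernelCalculus.bubble, comp_zero_right, comp_zero_left, tr_zero]

/-- [folklore] The relative commutator with the zero letter vanishes. -/
theorem conjV_zero (M : MKer D F) : conjV M 0 = 0 := by
  simp only [conjV, comp_zero_right, comp_zero_left, sub_self]

/-- [folklore] Subtractivity of the tadpole in the vertex (spread resolvent, localised vertices). -/
theorem tadpole_sub {A W₁ W₂ : MKer D F} (hA : Spr A) (h₁ : Loc W₁) (h₂ : Loc W₂) :
    tadpole A (W₁ - W₂) = tadpole A W₁ - tadpole A W₂ := by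
  have h := tadpole_add hA (h₁.sub h₂) h₂
  rw [sub_add_cancel] at h
  linarith

/-- [folklore] Subtractivity of the bubble in the first vertex. -/
theorem bubble_sub_left {A V₁ V₂ Z : MKer D F} (hA : Spr A) (h₁ : Loc V₁) (h₂ : Loc V₂) (hZ : Loc Z) :
    bubble A (V₁ - V₂) Z = bubble A V₁ Z - bubble A V₂ Z := by
  have h := bubble_add_left hA (h₁.sub h₂) h₂ hZ
  rw [sub_add_cancel] at h
  linarith

omit [Fintype F] in
/-- [folklore] A finite sum of localised kernels is localised. -/
theorem loc_finset_sum {ι : Type*} (s : Finset ι) {K : ι → MKer D F} (h : ∀ i, Loc (K i)) : Loc (∑ i ∈ s, K i) := by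
  classical
  refine Finset.induction_on s ?_ ?_
  · simp only [Finset.sum_empty]; exact loc_zero
  · intro a s ha ih
    rw [Finset.sum_insert ha]
    exact (h a).add ih

/-- [folklore] The tadpole of a finite sum of localised vertices is the sum of the tadpoles. -/
theorem tadpole_finset_sum {ι : Type*} (s : Finset ι) {A : MKer D F} {W : ι → MKer D F} (hA : Spr A) (h : ∀ i, Loc (W i)) :
    tadpole A (∑ i ∈ s, W i) = ∑ i ∈ s, tadpole A (W i) := by
  classical
  refine Finset.induction_on s ?_ ?_
  · simp only [Finset.sum_empty, tadpole_zero]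
  · intro a s ha ih
    rw [Finset.sum_insert ha, Finset.sum_insert ha, tadpole_add hA (h a) (loc_finset_sum s h), ih]

/-- [folklore] The bubble of a finite sum of localised vertices in the first slot is the sum of the bubbles. -/
theorem bubble_finset_sum_left {ι : Type*} (s : Finset ι) {A Z : MKer D F} {V : ι → MKer D F} (hA : Spr A) (h : ∀ i, Loc (V i))
    (hZ : Loc Z) : bubble A (∑ i ∈ s, V i) Z = ∑ i ∈ s, bubble A (V i) Z := by
  classical
  refine Finset.induction_on s ?_ ?_
  · simp only [Finset.sum_empty, bubble_zero_left]
  · intro a s ha ih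
    rw [Finset.sum_insert ha, Finset.sum_insert ha, bubble_add_left hA (h a) (loc_finset_sum s h) hZ, ih]

end Helpers

/-! ## §1 The Ward identity of the resolvent Hessian from conjugated pure-gauge vertex laws — relative inverse -/

section General

variable {D : ℕ} {F : Type*} [Fintype F]

/-- **THE WARD IDENTITY OF THE RESOLVENT HESSIAN, CONJUGATED PURE-GAUGE LAWS, RELATIVE INVERSE.**  Let `A`, `𝕄`, `E` be spread with
`RelInv A 𝕄 E`, the vertex families localised, the generator family `X y` and the contact family `X₂ y ν y′` localised and commuting
with `E`, and the remainder family `N y ν y′` localised.  If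
(W1′) `divV V y = conjV 𝕄 (X y)` — the pure-gauge first-order vertex is the relative commutator of `𝕄` with the generator;
(W2♮) `divW W y ν y′ = conjW 𝕄 0 (V ν y′) (X y) 0 (X₂ y ν y′) + N y ν y′` with `tadpole A (N y ν y′) = 0` — the pure-gauge slice of the
second-order table is the generator's action on the first jet plus a chart contact, up to a tadpole-null remainder;
then `Σ_μ (hess μ (y − e_μ) ν y′ − hess μ y ν y′) = 0`.  Proof: the Ward sum is `½·tadpole A (divW) − ½·bubble A (divV) (V ν y′)`, and
`ChartConjugationRelative.hess_conj_invariant_rel` at `V := 0, W := 0, X′ := 0` says `½·tadpole A (conjW 𝕄 0 V′ X 0 X₂) = ½·bubble A (conjV 𝕄 X) V′`.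
[folklore] -/
theorem ward_hess_conj_rel {A M E : MKer D F} {V : Fin D → (Fin D → ℤ) → MKer D F}
    {W : Fin D → (Fin D → ℤ) → Fin D → (Fin D → ℤ) → MKer D F} (hA : Spr A) (hM : Spr M) (hE : Spr E) (hR : RelInv A M E)
    (hV : ∀ μ y, Loc (V μ y)) (hW : ∀ μ y ν y', Loc (W μ y ν y')) {X : (Fin D → ℤ) → MKer D F}
    {X₂ Nr : (Fin D → ℤ) → Fin D → (Fin D → ℤ) → MKer D F} (hX : ∀ y, Loc (X y)) (hX₂ : ∀ y ν y', Loc (X₂ y ν y'))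
    (hNr : ∀ y ν y', Loc (Nr y ν y')) (hEX : ∀ y, comp E (X y) = comp (X y) E)
    (hEX₂ : ∀ y ν y', comp E (X₂ y ν y') = comp (X₂ y ν y') E) (hVd : ∀ y, divV V y = conjV M (X y))
    (hWd : ∀ y ν y', divW W y ν y' = conjW M 0 (V ν y') (X y) 0 (X₂ y ν y') + Nr y ν y')
    (hN0 : ∀ y ν y', tadpole A (Nr y ν y') = 0) (y : Fin D → ℤ) (ν : Fin D) (y' : Fin D → ℤ) :
    ∑ μ, (hess A V W μ (y - unitVec μ) ν y' - hess A V W μ y ν y') = 0 := by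
  -- step 1: the Ward sum is `½·tadpole A (divW) − ½·bubble A (divV) (V ν y′)`
  have e1 : ∑ μ, (hess A V W μ (y - unitVec μ) ν y' - hess A V W μ y ν y')
      = (1 / 2 : ℝ) * tadpole A (divW W y ν y') - (1 / 2 : ℝ) * bubble A (divV V y) (V ν y') := by
    simp only [ExpKernelCalculus.hess, KernelWard.divW, KernelWard.divV]
    rw [tadpole_finset_sum _ hA (fun μ => (hW μ (y - unitVec μ) ν y').sub (hW μ y ν y')),
      bubble_finset_sum_left _ hA (fun μ => (hV μ (y - unitVec μ)).sub (hV μ y)) (hV ν y'), Finset.mul_sum, Finset.mul_sum,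
      ← Finset.sum_sub_distrib]
    refine Finset.sum_congr rfl fun μ _ => ?_
    rw [tadpole_sub hA (hW _ _ _ _) (hW _ _ _ _), bubble_sub_left hA (hV _ _) (hV _ _) (hV _ _)]
    ring
  -- step 2: chart-conjugation invariance at the bare jet zero
  have key := hess_conj_invariant_rel hA hM hE hR loc_zero (hV ν y') loc_zero (hX y) loc_zero (hX₂ y ν y') (hEX y)
    (by rw [comp_zero_right, comp_zero_left]) (hEX₂ y ν y')
  simp only [zero_add, add_zero, conjV_zero, tadpole_zero, bubble_zero_left, mul_zero, sub_zero] at key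
  -- step 3: assemble
  rw [e1, hVd y, hWd y ν y', tadpole_add hA (loc_conjW hM loc_zero (hV ν y') (hX y) loc_zero (hX₂ y ν y')) (hNr y ν y'),
    hN0 y ν y', add_zero]
  exact key

/-- **THE DIFFERENCE-VARIABLE FORM, RELATIVE INVERSE** (`KernelWard.wardTransversal_flip_hessKer` twin): under block-translation
covariance the Ward identity of `ward_hess_conj_rel` is `PolarizationSign.WardTransversal` of the FLIPPED kernel `z ↦ hessKer μ ν (−z)`.
[folklore] -/
theorem wardTransversal_flip_hessKer_conj_rel {A M E : MKer D F} {V : Fin D → (Fin D → ℤ) → MKer D F}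
    {W : Fin D → (Fin D → ℤ) → Fin D → (Fin D → ℤ) → MKer D F} {N : ℕ} (hA : Spr A) (hM : Spr M) (hE : Spr E)
    (hR : RelInv A M E) (hcov : BlockCovariant A V W N) (hV : ∀ μ y, Loc (V μ y)) (hW : ∀ μ y ν y', Loc (W μ y ν y'))
    {X : (Fin D → ℤ) → MKer D F} {X₂ Nr : (Fin D → ℤ) → Fin D → (Fin D → ℤ) → MKer D F} (hX : ∀ y, Loc (X y))
    (hX₂ : ∀ y ν y', Loc (X₂ y ν y')) (hNr : ∀ y ν y', Loc (Nr y ν y')) (hEX : ∀ y, comp E (X y) = comp (X y) E)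
    (hEX₂ : ∀ y ν y', comp E (X₂ y ν y') = comp (X₂ y ν y') E) (hVd : ∀ y, divV V y = conjV M (X y))
    (hWd : ∀ y ν y', divW W y ν y' = conjW M 0 (V ν y') (X y) 0 (X₂ y ν y') + Nr y ν y')
    (hN0 : ∀ y ν y', tadpole A (Nr y ν y') = 0) :
    WardTransversal (fun μ ν z => hessKer A V W μ ν (-z)) := by
  intro ν z
  have h := ward_hess_conj_rel hA hM hE hR hV hW hX hX₂ hNr hEX hEX₂ hVd hWd hN0 0 ν (-z)
  have e : ∀ μ : Fin D, hess A V W μ (0 - unitVec μ) ν (-z) - hess A V W μ 0 ν (-z)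
      = hessKer A V W μ ν (-(z - unitVec μ)) - hessKer A V W μ ν (-z) := by
    intro μ
    rw [hess_eq_hessKer hcov, hess_eq_hessKer hcov]
    congr 2 <;> abel
  simpa only [e] using h

end General

/-! ## §2 The packed level: block bookkeeping of the pure-gauge vertex and the `hW` END over the relative sockets -/

section Packed

variable {d N : ℕ}

/-- [folklore] THE PURE-GAUGE WEIGHT of the coarse site `y` read on the fine leg `(u, κ′)`: `1_{B(y)}(u + e_κ′) − 1_{B(y)}(u)` — the fine
pure gauge `dλ` of the block-constant lift `λ = 1_{B(y)}` of the coarse `δ_y` (supported on the bonds crossing `∂B(y)`). -/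
def gaugeWt (N : ℕ) (y : Fin (d + 1) → ℤ) (κ' : Fin (d + 1)) (u : Fin (d + 1) → ℤ) : ℝ :=
  (if blk N (u + unitVec κ') = y then 1 else 0) - (if blk N u = y then 1 else 0)

/-- [folklore] **BLOCK BOOKKEEPING OF THE PURE-GAUGE VERTEX**: the coarse divergence of the chain-rule vertex is the superposition of
the stencils with the coarse divergence of the ℋ-columns as weights. -/
theorem divV_vertexOfK {K : MKer (d + 1) (Fib d)} (hK : ∃ δ C : ℝ, 0 < δ ∧ 0 ≤ C ∧ Decays K C δ)
    {S : Fin (d + 1) → (Fin (d + 1) → ℤ) → MKer (d + 1) (Fib d)} {Cs δs : ℝ} (hS : LocStencil S Cs δs) (hδs : 0 < δs)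
    (y : Fin (d + 1) → ℤ) :
    divV (vertexOfK K N S) y = ∑ κ', wsum (fun u => ∑ μ, (colH K N μ (y - unitVec μ) κ' u - colH K N μ y κ' u)) (S κ') := by
  have hB : ∀ κ' u x z a b, |S κ' u x z a b| ≤ Cs := abs_le_of_locStencil hS hδs.le
  have hs : ∀ (μ : Fin (d + 1)) (w : Fin (d + 1) → ℤ) (κ' : Fin (d + 1)) (x z : Fin (d + 1) → ℤ) (a b : Fib d),
      Summable fun u => colH K N μ w κ' u * S κ' u x z a b := fun μ w κ' x z a b =>
    Summable.of_norm_bounded ((summable_abs_colH (N := N) hK μ w κ').mul_right Cs) (fun u => by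
      rw [Real.norm_eq_abs, abs_mul]; exact mul_le_mul_of_nonneg_left (hB κ' u x z a b) (abs_nonneg _))
  funext x z a b
  simp only [KernelWard.divV, Finset.sum_apply, Pi.sub_apply, vertexOfK, OneStepResolventKernel.wsum]
  simp only [← Finset.sum_sub_distrib]
  rw [Finset.sum_comm]
  refine Finset.sum_congr rfl fun κ' _ => ?_
  have e : ∀ μ : Fin (d + 1), (∑' u, colH K N μ (y - unitVec μ) κ' u * S κ' u x z a b) - (∑' u, colH K N μ y κ' u * S κ' u x z a b)
      = ∑' u, (colH K N μ (y - unitVec μ) κ' u - colH K N μ y κ' u) * S κ' u x z a b := fun μ => by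
    rw [← (hs μ _ κ' x z a b).tsum_sub (hs μ y κ' x z a b)]
    exact tsum_congr fun u => by ring
  simp only [e]
  rw [← Summable.tsum_finsetSum (fun μ _ => (((hs μ (y - unitVec μ) κ' x z a b).sub (hs μ y κ' x z a b)).congr
    (fun u => by show _ - _ = _; ring)))]
  exact tsum_congr fun u => by rw [Finset.sum_mul]

/-- [folklore] THE SUPERPOSITION WITH THE BLOCK INDICATOR AS WEIGHT is the finite block sum. -/
theorem wsum_blockInd (hN : 1 ≤ N) (y : Fin (d + 1) → ℤ) (T : (Fin (d + 1) → ℤ) → MKer (d + 1) (Fib d)) :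
    wsum (fun u => if blk N u = y then (1 : ℝ) else 0) T = ∑ v ∈ box (d + 1) N, T ((N : ℤ) • y + toSite v) := by
  funext x z a b
  simp only [OneStepResolventKernel.wsum, Finset.sum_apply]
  rw [tsum_eq_sum (s := (box (d + 1) N).image (fun v => (N : ℤ) • y + toSite v)) (fun u hu => ?_)]
  · rw [Finset.sum_image (fun v _ w _ h => toSite_injective (add_left_cancel h))]
    refine Finset.sum_congr rfl fun v hv => ?_
    rw [if_pos (blk_block y hv), one_mul]
  · have hb : blk N u ≠ y := by
      intro hb
      apply hu
      rw [Finset.mem_image]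
      exact ⟨off N u, off_mem_box hN u, by rw [← hb, blk_add_off hN u]⟩
    rw [if_neg hb, zero_mul]

/-- [folklore] … and with the SHIFTED block indicator `u ↦ 1_{B(y)}(u + e)` as weight, the shifted block sum. -/
theorem wsum_blockInd_shift (hN : 1 ≤ N) (y e : Fin (d + 1) → ℤ) (T : (Fin (d + 1) → ℤ) → MKer (d + 1) (Fib d)) :
    wsum (fun u => if blk N (u + e) = y then (1 : ℝ) else 0) T = ∑ v ∈ box (d + 1) N, T ((N : ℤ) • y + toSite v - e) := by
  rw [← wsum_blockInd hN y (fun u => T (u - e))]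
  funext x z a b
  simp only [OneStepResolventKernel.wsum]
  rw [← (Equiv.subRight e).tsum_eq]
  simp only [Equiv.subRight_apply, sub_add_cancel]

/-- [folklore] A weight supported in (a translate of) one block is finitely supported, hence absolutely summable against any family. -/
theorem summable_blockInd_mul (hN : 1 ≤ N) (y e : Fin (d + 1) → ℤ) (f : (Fin (d + 1) → ℤ) → ℝ) :
    Summable fun u => (if blk N (u + e) = y then (1 : ℝ) else 0) * f u := by
  refine summable_of_ne_finset_zero (s := (box (d + 1) N).image (fun v => (N : ℤ) • y + toSite v - e)) (fun u hu => ?_)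
  have hb : blk N (u + e) ≠ y := by
    intro hb
    apply hu
    rw [Finset.mem_image]
    exact ⟨off N (u + e), off_mem_box hN (u + e), by rw [← hb, blk_add_off hN (u + e), add_sub_cancel_right]⟩
  rw [if_neg hb, zero_mul]

/-- [folklore] THE SUPERPOSITION WITH THE PURE-GAUGE WEIGHT is the block sum of the fine pure-gauge differences of the family. -/
theorem wsum_gaugeWt (hN : 1 ≤ N) (c : ℝ) (y : Fin (d + 1) → ℤ) (κ' : Fin (d + 1)) (T : (Fin (d + 1) → ℤ) → MKer (d + 1) (Fib d)) :
    wsum (fun u => c * gaugeWt N y κ' u) T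
      = c • ∑ v ∈ box (d + 1) N, (T ((N : ℤ) • y + toSite v - unitVec κ') - T ((N : ℤ) • y + toSite v)) := by
  have h₁ := wsum_blockInd_shift hN y (unitVec κ') T
  have h₂ := wsum_blockInd hN y T
  funext x z a b
  have h₁' := congr_fun (congr_fun (congr_fun (congr_fun h₁ x) z) a) b
  have h₂' := congr_fun (congr_fun (congr_fun (congr_fun h₂ x) z) a) b
  simp only [OneStepResolventKernel.wsum, Finset.sum_apply] at h₁' h₂' ⊢
  simp only [Pi.smul_apply, Finset.sum_apply, Pi.sub_apply, smul_eq_mul, Finset.sum_sub_distrib]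
  rw [← h₁', ← h₂', ← (summable_blockInd_mul hN y (unitVec κ') _).tsum_sub
    (by simpa only [add_zero] using summable_blockInd_mul hN y 0 fun u => T u x z a b), ← tsum_mul_left]
  exact tsum_congr fun u => by simp only [gaugeWt]; ring

/-- **THE PURE-GAUGE VERTEX OF THE CHAIN-RULE FAMILY IS A RELATIVE COMMUTATOR** from (hH) an ℋ-COLUMN WARD LAW of `K` — the coarse
divergence of the ℋ-columns is `c_H` times the pure-gauge weight (for the one-step resolvent: rule 3 `(G ∘ 𝕄) ∘ E = E` of `RelInv` read on the
test vector `(dλ ; 0)`, `λ = 1_{B(y)}`, with `d*d ∘ d = 0` and the averaging of an exact form; a SOCKET here) — and (hSd) a BLOCK STENCIL WARD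
LAW WITH CONTACT `c_H • Σ_{v ∈ box} divV S (N•y + v) = conjV 𝕄 (X y)` (SOCKET). [folklore] -/
theorem divV_vertexOfK_eq_conjV {K M : MKer (d + 1) (Fib d)} (hK : ∃ δ C : ℝ, 0 < δ ∧ 0 ≤ C ∧ Decays K C δ) (hN : 1 ≤ N)
    {S : Fin (d + 1) → (Fin (d + 1) → ℤ) → MKer (d + 1) (Fib d)} {Cs δs : ℝ} (hS : LocStencil S Cs δs) (hδs : 0 < δs) (cH : ℝ)
    (hH : ∀ (y : Fin (d + 1) → ℤ) (κ' : Fin (d + 1)) (u : Fin (d + 1) → ℤ),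
      ∑ μ, (colH K N μ (y - unitVec μ) κ' u - colH K N μ y κ' u) = cH * gaugeWt N y κ' u)
    {X : (Fin (d + 1) → ℤ) → MKer (d + 1) (Fib d)}
    (hSd : ∀ y : Fin (d + 1) → ℤ, cH • ∑ v ∈ box (d + 1) N, divV S ((N : ℤ) • y + toSite v) = conjV M (X y))
    (y : Fin (d + 1) → ℤ) : divV (vertexOfK K N S) y = conjV M (X y) := by
  rw [divV_vertexOfK (N := N) hK hS hδs y, ← hSd y]
  have e : ∀ κ' : Fin (d + 1), wsum (fun u => ∑ μ, (colH K N μ (y - unitVec μ) κ' u - colH K N μ y κ' u)) (S κ')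
      = cH • ∑ v ∈ box (d + 1) N, (S κ' ((N : ℤ) • y + toSite v - unitVec κ') - S κ' ((N : ℤ) • y + toSite v)) := by
    intro κ'
    rw [← wsum_gaugeWt hN cH y κ' (S κ')]
    congr 1
    funext u
    exact hH y κ' u
  simp only [e, ← Finset.smul_sum]
  congr 1
  rw [Finset.sum_comm]
  refine Finset.sum_congr rfl fun v _ => ?_
  simp only [KernelWard.divV]

/-- **THE TYPED WARD LAW OF A RESOLVENT HESSIAN KERNEL FROM CONJUGATED PURE-GAUGE JET LAWS — RELATIVE INVERSE** (the `hW` twin of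
`ChartConjugationRelativeEnd.axisReflectionCovariant_flipK_hessKer_conj_rel`).  BINDERS: a decaying, block-translation-invariant `K`, spread `𝕄`, `E`
with `RelInv K 𝕄 E`; jet data `J` with the translation laws (St), (Wt); the ℋ-column Ward law (hH) with constant `c_H`; a localised generator family
`X y` and contact family `X₂ y ν y′` commuting with `E`, a localised tadpole-null remainder `N y ν y′`; the block stencil Ward law with contact
(hSd) and the second-order pure-gauge law (hWd).  CONCLUSION: `WardTransversal (flipK (hessKer K (vertexOfK K N J.S) J.W))`.  All laws and rules
are HYPOTHESES, never facts. [folklore] -/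
theorem wardTransversal_flipK_hessKer_conj_rel {K M E : MKer (d + 1) (Fib d)}
    (hKd : ∃ δ C : ℝ, 0 < δ ∧ 0 ≤ C ∧ Decays K C δ) (hKs : ∀ t : Fin (d + 1) → ℤ, shiftK (-((N : ℤ) • t)) K = K) (hN : 1 ≤ N)
    (hM : Spr M) (hE : Spr E) (hR : RelInv K M E) (J : JetData d N)
    (hSt : ∀ (κ' : Fin (d + 1)) (u t : Fin (d + 1) → ℤ), J.S κ' (u + (N : ℤ) • t) = shiftK (-((N : ℤ) • t)) (J.S κ' u))
    (hWt : ∀ (μ : Fin (d + 1)) (y : Fin (d + 1) → ℤ) (ν : Fin (d + 1)) (y' t : Fin (d + 1) → ℤ),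
      J.W μ (y + t) ν (y' + t) = shiftK (-((N : ℤ) • t)) (J.W μ y ν y'))
    (cH : ℝ) (hH : ∀ (y : Fin (d + 1) → ℤ) (κ' : Fin (d + 1)) (u : Fin (d + 1) → ℤ),
      ∑ μ, (colH K N μ (y - unitVec μ) κ' u - colH K N μ y κ' u) = cH * gaugeWt N y κ' u)
    (X : (Fin (d + 1) → ℤ) → MKer (d + 1) (Fib d)) (hX : ∀ y, Loc (X y)) (hEX : ∀ y, comp E (X y) = comp (X y) E)
    (X₂ Nr : (Fin (d + 1) → ℤ) → Fin (d + 1) → (Fin (d + 1) → ℤ) → MKer (d + 1) (Fib d)) (hX₂ : ∀ y ν y', Loc (X₂ y ν y'))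
    (hNr : ∀ y ν y', Loc (Nr y ν y')) (hEX₂ : ∀ y ν y', comp E (X₂ y ν y') = comp (X₂ y ν y') E)
    (hSd : ∀ y : Fin (d + 1) → ℤ, cH • ∑ v ∈ box (d + 1) N, divV J.S ((N : ℤ) • y + toSite v) = conjV M (X y))
    (hWd : ∀ (y : Fin (d + 1) → ℤ) (ν : Fin (d + 1)) (y' : Fin (d + 1) → ℤ),
      divW J.W y ν y' = conjW M 0 (vertexOfK K N J.S ν y') (X y) 0 (X₂ y ν y') + Nr y ν y')
    (hN0 : ∀ y ν y', tadpole K (Nr y ν y') = 0) :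
    WardTransversal (flipK (hessKer K (vertexOfK K N J.S) J.W)) := by
  obtain ⟨Cv, δv, hδv, hV⟩ := vertexFamily_vertexOfK' (N := N) hKd J.loc J.δ_pos
  have hKspr : Spr K := by obtain ⟨δK, CK, hδK, _, hK⟩ := hKd; exact ⟨CK, δK, hδK, hK⟩
  have hVl : ∀ μ y, Loc (vertexOfK K N J.S μ y) := fun μ y => ⟨_, _, Cv, δv, hδv, hV μ y⟩
  have hWl : ∀ μ y ν y', Loc (J.W μ y ν y') := fun μ y ν y' => ⟨_, _, J.Cw, J.δ, J.δ_pos, J.loc₂ μ y ν y'⟩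
  have hcov : BlockCovariant K (vertexOfK K N J.S) J.W N := ⟨hKs, vertexOfK_translate_block hKs hSt, hWt⟩
  exact wardTransversal_flip_hessKer_conj_rel hKspr hM hE hR hcov hVl hWl hX hX₂ hNr hEX hEX₂
    (fun y => divV_vertexOfK_eq_conjV (N := N) hKd hN J.loc J.δ_pos cH hH hSd y) hWd hN0

end Packed

end

end Summit.QuantumFields.BalabanUV.Beta.KernelWardRelative
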